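import Summits.AtomisticToContinuum.HydrodynamicLimit.Theses.TwoClocks

/-!
# Crux-ideate sketch — stmt-AtomisticToContinuum-14442 `KineticWindowLDUniform` (ideator 3, round 1)

First lemmas / transfer targets for the two idea cards

* card A `weak-star-covering-chaos-defect`: `WeightedClosure` (first lemma),
  `PointwiseWindowBound` (transfer target C⁺: β-free pointwise-target bounds for the
  window-averaged empirical one-body measure), `PointwiseToPressure` (the covering step as an
  implication);
* card B `per-step-tilt-cumulant-currency`: `CumulantCurrency` (first lemma, one real variable),
  `KineticCumulantClustering` (transfer target C⁺), `CumulantsToWindowLD` (the implication).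

Nothing here is proved; every declaration is a `Prop` (no `sorry`).
-/

noncomputable section

namespace Summit.AtomisticToContinuum.HydrodynamicLimit.Cruxes.KineticWindowLDUniform.IdeatorThreeSketch

open MeasureTheory ProbabilityTheory Filter
open scoped ENNReal Topology BoundedContinuousFunction

open Literature.MathematicalPhysics.KineticTheory (T3 V3 hsDiameter localGibbsLaw)
open Literature.Analysis.FluidPDE (HardSphereFlow Config localMaxwellian)

/-- The hard-sphere flow type of the crux: `N+1` spheres of diameter `σ(N+1)^{-1/3}` on `𝕋³`.
[folklore] -/
abbrev Flow (σ : ℝ) (N : ℕ) :=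
  HardSphereFlow (Literature.Analysis.FluidPDE.Torus.geometry (Fin 3)) (hsDiameter σ N) (N + 1)

/-- The kinetic window `w_N = τ (N+1)^{-1/3}` (≍ τπσ²√θ mean free times). [folklore] -/
def window (τ : ℝ) (N : ℕ) : ℝ :=
  τ * ((N : ℝ) + 1) ^ (-(1 / 3 : ℝ))

/-- The crux's window functional `S^N_τ(F)(z) = Σ_i w⁻¹ ∫₀^w F((Φ_r z)_i) dr`. [folklore] -/
def windowSum {σ : ℝ} {N : ℕ} (Φ : Flow σ N) (τ : ℝ) (F : T3 × V3 → ℝ)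
    (z : Config (N + 1) (Fin 3) T3) : ℝ :=
  ∑ i : Fin (N + 1), (window τ N)⁻¹ * ∫ r in (0 : ℝ)..(window τ N), F ((Φ.flow r z) i)

/-- The crux's fast class at the profiles `(u₀, θ₀)`: continuous, quadratic growth with weighted
norm `≤ Cw`, orthogonal at every `x` under `M_(1,u₀(x),θ₀(x))` to `1, v_j, |v|²`. [folklore] -/
def IsFast (θ₀ : T3 → ℝ) (u₀ : T3 → V3) (Cw : ℝ) (F : T3 × V3 → ℝ) : Prop :=
  Continuous F ∧ (∀ y, |F y| ≤ Cw * (1 + ‖y.2‖ ^ 2)) ∧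
    (∀ x, ∫ v, F (x, v) * localMaxwellian 1 (θ₀ x) (u₀ x) v = 0) ∧
    (∀ x (j : Fin 3), ∫ v, F (x, v) * v j * localMaxwellian 1 (θ₀ x) (u₀ x) v = 0) ∧
    (∀ x, ∫ v, F (x, v) * ‖v‖ ^ 2 * localMaxwellian 1 (θ₀ x) (u₀ x) v = 0)

/-- The crux's conclusion for fixed data `(σ, a, θ₀, u₀, Φ, F)` and a given `β₀`:
`∀ |β| ≤ β₀ ∀ ε ∃ τ ∃ N₀ ∀ N ≥ N₀ : ∫ exp(β S) dλ^N ≤ exp(ε(N+1))`. [folklore] -/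
def WindowLDConclusion (σ : ℝ) (a θ₀ : T3 → ℝ) (u₀ : T3 → V3) (Φ : (N : ℕ) → Flow σ N)
    (F : T3 × V3 → ℝ) (β₀ : ℝ) : Prop :=
  ∀ β : ℝ, |β| ≤ β₀ → ∀ ε : ℝ, 0 < ε → ∃ τ : ℝ, 0 < τ ∧ ∃ N₀ : ℕ, ∀ N : ℕ, N₀ ≤ N →
    ∫⁻ z, ENNReal.ofReal (Real.exp (β * windowSum (Φ N) τ F z))
        ∂(localGibbsLaw σ a u₀ θ₀ N (Φ N)) ≤ ENNReal.ofReal (Real.exp (ε * ((N : ℝ) + 1)))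

/-- Sanity restatement: the crux is `∃ η₀ ∀ data (guard) ∀ F fast ∃ β₀, WindowLDConclusion …`.
[folklore] -/
def CruxRestated : Prop :=
  ∃ η₀ : ℝ, 0 < η₀ ∧ ∀ (a θ₀ : T3 → ℝ) (u₀ : T3 → V3), Continuous a → Continuous θ₀ →
    Continuous u₀ → (∀ x, 0 < a x) → (∀ x, 0 < θ₀ x) → ∀ σ : ℝ, 0 < σ →
    σ ^ 3 * (⨆ x, a x) ≤ η₀ * ∫ x, a x → ∀ Φ : (N : ℕ) → Flow σ N, ∀ (Cw : ℝ) (F : T3 × V3 → ℝ),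
    IsFast θ₀ u₀ Cw F → ∃ β₀ : ℝ, 0 < β₀ ∧ WindowLDConclusion σ a θ₀ u₀ Φ F β₀

/-! ## Card A — weak-star covering: compactness kills β -/

/-- **First lemma of card A (`WeightedClosure`).** Energy conservation along good orbits
(`IsHardSphereTrajectory.configEnergy_eq_holds`) gives, pathwise,
`|S(F) − S(G)| ≤ δ·Σ_i w⁻¹∫(1+|v_i(r)|²)dr = δ·((N+1) + 2·configEnergy z)` whenever
`|F − G| ≤ δ(1+|v|²)`, and `configEnergy` has a Gaussian exponential moment under the velocity
fibres of the local Gibbs law; so by Hölder (p = q = 2) the crux's conclusion is STABLE under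
weighted-uniform approximation with a COMMON `β₀` (at the price `β₀ ↦ β₀/2`), with no dynamics.
This is the step that reduces general continuous fast `F` to a separable dense class
(Stone–Weierstrass on `𝕋³ × {|v| ≤ M}` plus re-orthogonalisation, whose correction is small in
the weighted norm only). [folklore] -/
def WeightedClosure : Prop :=
  ∀ (σ : ℝ), 0 < σ → ∀ (a θ₀ : T3 → ℝ) (u₀ : T3 → V3), Continuous a → Continuous θ₀ →
    Continuous u₀ → (∀ x, 0 < a x) → (∀ x, 0 < θ₀ x) →
    ∀ (Φ : (N : ℕ) → Flow σ N), (∀ N, IsProbabilityMeasure (localGibbsLaw σ a u₀ θ₀ N (Φ N))) →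
    ∀ (F : T3 × V3 → ℝ) (G : ℕ → T3 × V3 → ℝ) (δ : ℕ → ℝ),
    Continuous F → (∀ n, Continuous (G n)) →
    (∀ n y, |F y - G n y| ≤ δ n * (1 + ‖y.2‖ ^ 2)) → Tendsto δ atTop (𝓝 0) →
    ∀ β₀ : ℝ, 0 < β₀ → (∀ n, WindowLDConclusion σ a θ₀ u₀ Φ (G n) β₀) →
    WindowLDConclusion σ a θ₀ u₀ Φ F (β₀ / 2)

/-- The window-averaged empirical one-body measure of the orbit of `z`:
`μ^N_τ(z) := (N+1)⁻¹ Σ_i w⁻¹ ∫₀^w δ_{(Φ_r z)_i} dr`, a probability measure on `𝕋³ × ℝ³` for good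
`z` (push-forward of normalised Lebesgue measure on the window under `r ↦ (Φ_r z)_i`, averaged
over `i`). [folklore] -/
def windowEmpirical {σ : ℝ} {N : ℕ} (Φ : Flow σ N) (τ : ℝ) (z : Config (N + 1) (Fin 3) T3) :
    Measure (T3 × V3) :=
  ((N : ℝ≥0∞) + 1)⁻¹ •
    Measure.sum fun i : Fin (N + 1) =>
      (ENNReal.ofReal (window τ N))⁻¹ •
        (volume.restrict (Set.Ioc (0 : ℝ) (window τ N))).map fun r => (Φ.flow r z) i

/-- **Transfer target of card A (`PointwiseWindowBound β₀`, "C⁺").** β-FREE pointwise-target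
large-deviation upper bounds for the window-averaged empirical one-body measure: for every
target probability measure `ν` on `𝕋³ × ℝ³` with finite energy and every fast `F` with weighted
norm `≤ 1`, some weak neighbourhood `U` of `ν` (finitely many bounded continuous tests) has
`λ^N(μ^N_τ ∈ U) ≤ exp(−(N+1)(β₀ ∫F dν − ε))` for all long windows. No exponential moment, no
tilt: ONE macroscopic scenario at a time, at SHALLOW depth (the bound is vacuous unless
`β₀∫F dν > ε`, and `β₀∫F dν ≤ β₀(1 + 2·energy(ν))` is small with `β₀`). [folklore] -/
def PointwiseWindowBound (β₀ : ℝ) : Prop :=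
  ∃ η₀ : ℝ, 0 < η₀ ∧ ∀ (a θ₀ : T3 → ℝ) (u₀ : T3 → V3), Continuous a → Continuous θ₀ →
    Continuous u₀ → (∀ x, 0 < a x) → (∀ x, 0 < θ₀ x) → ∀ σ : ℝ, 0 < σ →
    σ ^ 3 * (⨆ x, a x) ≤ η₀ * ∫ x, a x → ∀ Φ : (N : ℕ) → Flow σ N, ∀ F : T3 × V3 → ℝ,
    IsFast θ₀ u₀ 1 F →
    ∀ (ν : Measure (T3 × V3)) [IsProbabilityMeasure ν], Integrable (fun y => ‖y.2‖ ^ 2) ν →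
    ∀ ε : ℝ, 0 < ε →
    ∃ (m : ℕ) (g : Fin m → (T3 × V3 →ᵇ ℝ)) (δ : ℝ), 0 < δ ∧ ∃ τ₀ : ℝ, 0 < τ₀ ∧
      ∀ τ : ℝ, τ₀ ≤ τ → ∃ N₀ : ℕ, ∀ N : ℕ, N₀ ≤ N →
        localGibbsLaw σ a u₀ θ₀ N (Φ N)
            {z | ∀ k : Fin m, |∫ y, g k y ∂(windowEmpirical (Φ N) τ z) - ∫ y, g k y ∂ν| < δ} ≤
          ENNReal.ofReal (Real.exp (-(((N : ℝ) + 1) * (β₀ * ∫ y, F y ∂ν - ε))))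

/-- Window-uniform exponential tightness in the WEIGHTED sense (uniform integrability of `|v|²`
under the window-averaged empirical measure at every exponential scale). At global equilibrium
this is static (Jensen in time + invariance of the canonical Gibbs law + Gaussian tails); under
local Gibbs data it is the shared quasi-invariance object (WQI/QI) of the sister crux 14662's
cards, or follows from TwoClocks' own `LocalGibbsTransfer` architecture. Listed as an explicit
hypothesis of the covering step, not claimed. [folklore] -/
def WindowWeightedTightness : Prop :=
  ∃ η₀ : ℝ, 0 < η₀ ∧ ∀ (a θ₀ : T3 → ℝ) (u₀ : T3 → V3), Continuous a → Continuous θ₀ →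
    Continuous u₀ → (∀ x, 0 < a x) → (∀ x, 0 < θ₀ x) → ∀ σ : ℝ, 0 < σ →
    σ ^ 3 * (⨆ x, a x) ≤ η₀ * ∫ x, a x → ∀ Φ : (N : ℕ) → Flow σ N,
    ∀ κ : ℝ, 0 < κ → ∀ η : ℝ, 0 < η → ∃ M : ℝ, ∀ τ : ℝ, 0 < τ → ∃ N₀ : ℕ, ∀ N : ℕ, N₀ ≤ N →
      localGibbsLaw σ a u₀ θ₀ N (Φ N)
          {z | η < ∫ y, Set.indicator {y : T3 × V3 | M < ‖y.2‖} (fun y => ‖y.2‖ ^ 2) y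
              ∂(windowEmpirical (Φ N) τ z)} ≤
        ENNReal.ofReal (Real.exp (-(κ * ((N : ℝ) + 1))))

/-- **The covering step of card A as an implication**: pointwise bounds at depth `β₀` plus
weighted tightness give the crux (with `β₀` halved twice: once for the level grid / tightness
split, once for `WeightedClosure`). Pure large-deviation bookkeeping on the compact metrisable
space of sub-probability measures with bounded energy: exponential Chebyshev on a finite grid of
levels, a finite subcover of `{ν : β∫F dν ≥ t}` for each level, `τ :=` the max over the subcover.
[folklore] -/
def PointwiseToPressure : Prop :=
  ∀ β₀ : ℝ, 0 < β₀ → PointwiseWindowBound β₀ → WindowWeightedTightness → WeightedClosure →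
    ∃ η₀ : ℝ, 0 < η₀ ∧ ∀ (a θ₀ : T3 → ℝ) (u₀ : T3 → V3), Continuous a → Continuous θ₀ →
      Continuous u₀ → (∀ x, 0 < a x) → (∀ x, 0 < θ₀ x) → ∀ σ : ℝ, 0 < σ →
      σ ^ 3 * (⨆ x, a x) ≤ η₀ * ∫ x, a x → ∀ Φ : (N : ℕ) → Flow σ N, ∀ F : T3 × V3 → ℝ,
      IsFast θ₀ u₀ 1 F → WindowLDConclusion σ a θ₀ u₀ Φ F (β₀ / 4)

/-! ## Card B — the small parameter is β/τ′: cumulant currency -/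

/-- **First lemma of card B (`CumulantCurrency`, one real variable).** If a real statistic `X`
has a moment generating function finite on `(−2δ, 2δ)`, vanishing first cumulant and cumulants
`|κ_n| ≤ A·n!·Cⁿ/τ` for EVERY `n ≥ 2` (one power of `1/τ`, factorial growth, nothing more), then
`cgf X β ≤ 2AC²β²/τ` for `|β| ≤ min δ (1/(2C))`: cumulants of a WINDOW AVERAGE of `≍ τ` weakly
dependent blocks carry at least one factor `1/τ` at every order (`τ^{−(n−1)}` for the
connected-in-time part, `τ^{−n/2}` for the conserved-quantity variance-mixture part found in the MD
run), so bounds merely UNIFORM in the window give the `1/τ` law with `β₀ = 1/(2C)` = half the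
analyticity radius. (Proof: the Taylor series of `cgf` at `0` has radius `≥ 1/C`; `exp` of it is
analytic on that disc and agrees with `mgf` near `0`, hence on the disc, so `mgf` is zero-free there
and `cgf` equals its series; sum the geometric tail.) [folklore] -/
def CumulantCurrency : Prop :=
  ∀ (Ω : Type) [MeasurableSpace Ω] (μ : Measure Ω) [IsProbabilityMeasure μ] (X : Ω → ℝ)
    (A C τ δ : ℝ), 0 < A → 0 < C → 0 < τ → 0 < δ →
    (∀ t : ℝ, |t| < 2 * δ → Integrable (fun ω => Real.exp (t * X ω)) μ) →
    deriv (cgf X μ) 0 = 0 →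
    (∀ n : ℕ, 2 ≤ n → |iteratedDeriv n (cgf X μ) 0| ≤ A * n.factorial * C ^ n / τ) →
    ∀ β : ℝ, |β| ≤ min δ (1 / (2 * C)) → cgf X μ β ≤ 2 * A * C ^ 2 * β ^ 2 / τ

/-- **Transfer target of card B (`KineticCumulantClustering`, "C⁺").** Window-UNIFORM,
N-uniform, factorial ("tree-graph") bounds on the cumulants of the window functional under the
local Gibbs law with ONE power of the window at every order: `|κ_n(S^N_τ(F))| ≤ (N+1)·n!·Cⁿ/τ`
for `n ≥ 2`, `|κ₁| ≤ (N+1)·C/τ`, and a moment generating function finite on a fixed strip —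
`C, δ` depending on `σ`, the profiles and the weighted norm of `F`, NOT on `τ` or `N`.
Multilinear statistics only: no exponential moment at scale `N` is ever asked of the dynamics;
`n = 2` is window-uniform summability of the two-time covariance of the extensive fast field
(a Green–Kubo finiteness statement). [folklore] -/
def KineticCumulantClustering : Prop :=
  ∃ η₀ : ℝ, 0 < η₀ ∧ ∀ (a θ₀ : T3 → ℝ) (u₀ : T3 → V3), Continuous a → Continuous θ₀ →
    Continuous u₀ → (∀ x, 0 < a x) → (∀ x, 0 < θ₀ x) → ∀ σ : ℝ, 0 < σ →
    σ ^ 3 * (⨆ x, a x) ≤ η₀ * ∫ x, a x → ∀ Φ : (N : ℕ) → Flow σ N, ∀ (Cw : ℝ) (F : T3 × V3 → ℝ),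
    IsFast θ₀ u₀ Cw F →
    ∃ C : ℝ, 0 < C ∧ ∃ δ : ℝ, 0 < δ ∧ ∀ τ : ℝ, 1 ≤ τ → ∃ N₀ : ℕ, ∀ N : ℕ, N₀ ≤ N →
      (∀ t : ℝ, |t| < 2 * δ →
          Integrable (fun z => Real.exp (t * windowSum (Φ N) τ F z))
            (localGibbsLaw σ a u₀ θ₀ N (Φ N))) ∧
      |deriv (cgf (windowSum (Φ N) τ F) (localGibbsLaw σ a u₀ θ₀ N (Φ N))) 0| ≤
          ((N : ℝ) + 1) * C / τ ∧
      ∀ n : ℕ, 2 ≤ n →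
        |iteratedDeriv n (cgf (windowSum (Φ N) τ F) (localGibbsLaw σ a u₀ θ₀ N (Φ N))) 0| ≤
          ((N : ℝ) + 1) * n.factorial * C ^ n / τ

/-- **Card B as an implication** (bookkeeping only, via `CumulantCurrency` applied to the
centred statistic and `log ∫ e^{βS} = cgf S β` for a probability measure):
`KineticCumulantClustering → KineticWindowLDUniform` with `β₀ := min δ (1/(2C))`, `τ := 4(C+C²)/ε`. [folklore] -/
def CumulantsToWindowLD : Prop :=
  CumulantCurrency → KineticCumulantClustering →
    Summit.AtomisticToContinuum.HydrodynamicLimit.Theses.TwoClocks.KineticWindowLDUniform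

end Summit.AtomisticToContinuum.HydrodynamicLimit.Cruxes.KineticWindowLDUniform.IdeatorThreeSketch

end
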